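import Mathlib
import Summits.Ventures.HodgeRepro2.T5HeckeIsomorphismTransport
import Summits.Ventures.HodgeRepro2.T5HeckeDoubleCoset

/-!
# Transport of the double-coset operators: `ε(T_g) = T_{φ(g)}`

Blind cell `pub-hodge-repro2`, seat p8 (gen 13), Tier-5 kernel support.  `T5HeckeIsomorphismTransport`
(T5-142) gives `ε : H(G, K) ≃ₐ[k] H(G', K')` along `φ : G ≃* G'` with `φ(K) = K'`.  This file
identifies the images of the double-coset operators of `T5HeckeDoubleCoset` (T5-53): the induced
bijection `G/K ≃ G'/K'` maps the `K`-orbit of `gK` onto the `K'`-orbit of `φ(g)K'`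
(`quotientEquivOfMulEquiv_image_orbit`), the permutation-module equivalence maps the orbit vector
`1_{KgK/K}` to `1_{K'φ(g)K'/K'}` (`permEquivOfMulEquiv_orbitVector`), and since an element of
`H(G, K)` is determined by its value on `δ_K` (`heckeAlgebraEquivInvariants`):

* `heckeAlgebraEquivOfMulEquiv_doubleCosetOp` — **`ε(T_g) = T_{φ(g)}`**.

With `T5HeckeBasisCells` this transports the cell basis `{T_k}` of `H(U(antidiag(1,u,1)), K_U)` to
the basis `{T_{P a_k P⁻¹}}` of the record's `H(U(H), K_H)` (used in `T5InertHeckeCommutative`).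

README §8(d): uses an L-value-free non-vanishing device: NO.
-/

namespace Summit.Ventures.HodgeRepro2.T5HeckeIsomorphismTransportCells

open T5HeckePermutationModule T5HeckeIsomorphismTransport T5HeckeDoubleCoset

variable (k : Type*) [Field k] {G G' : Type*} [Group G] [Group G'] (φ : G ≃* G') {K : Subgroup G}
  {K' : Subgroup G'} (hK : ∀ g, g ∈ K ↔ φ g ∈ K')

omit k in
/-- The induced bijection maps the `K`-orbit of `gK` onto the `K'`-orbit of `φ(g)K'`. -/
theorem quotientEquivOfMulEquiv_image_orbit (g : G) :
    quotientEquivOfMulEquiv φ hK '' MulAction.orbit K (g : G ⧸ K) =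
      MulAction.orbit K' ((φ g : G') : G' ⧸ K') := by
  ext y
  constructor
  · rintro ⟨x, hx, rfl⟩
    obtain ⟨κ, rfl⟩ := MulAction.mem_orbit_iff.mp hx
    refine MulAction.mem_orbit_iff.mpr ⟨⟨φ κ, (hK κ).mp κ.2⟩, ?_⟩
    change (φ κ : G') • ((φ g : G') : G' ⧸ K') = quotientEquivOfMulEquiv φ hK ((κ : G) • (g : G ⧸ K))
    rw [quotientEquivOfMulEquiv_smul, quotientEquivOfMulEquiv_mk]
  · intro hy
    obtain ⟨κ', hκ'⟩ := MulAction.mem_orbit_iff.mp hy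
    refine ⟨(⟨φ.symm κ', (hK _).mpr (by rw [MulEquiv.apply_symm_apply]; exact κ'.2)⟩ : K) •
      (g : G ⧸ K), MulAction.mem_orbit _ _, ?_⟩
    change quotientEquivOfMulEquiv φ hK ((φ.symm κ' : G) • (g : G ⧸ K)) = y
    rw [quotientEquivOfMulEquiv_smul, quotientEquivOfMulEquiv_mk, MulEquiv.apply_symm_apply, ← hκ']
    rfl

/-- The permutation-module equivalence maps orbit vectors to orbit vectors
(`1_O ↦ 1_{e '' O}`, `O` finite). -/
theorem permEquivOfMulEquiv_orbitVector (O : Set (G ⧸ K)) (hO : O.Finite) :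
    permEquivOfMulEquiv k φ hK (orbitVector k K O) =
      orbitVector k K' (quotientEquivOfMulEquiv φ hK '' O) := by
  rw [orbitVector, orbitVector, finsum_mem_eq_finite_toFinset_sum _ hO,
    finsum_mem_eq_finite_toFinset_sum _ (hO.image _), map_sum]
  refine Finset.sum_equiv (quotientEquivOfMulEquiv φ hK) (fun x => ?_) (fun x _ => ?_)
  · rw [Set.Finite.mem_toFinset, Set.Finite.mem_toFinset,
      (quotientEquivOfMulEquiv φ hK).injective.mem_set_image]
  · rw [permEquivOfMulEquiv, MonoidAlgebra.mapDomainLinearEquiv_single]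

/-- The underlying endomorphism of `ε(T)` is `e ∘ T ∘ e⁻¹`. -/
theorem coe_heckeAlgebraEquivOfMulEquiv (T : heckeAlgebra k K) :
    (heckeAlgebraEquivOfMulEquiv k φ hK T : Module.End k (MonoidAlgebra k (G' ⧸ K'))) =
      (permEquivOfMulEquiv k φ hK).conjAlgEquiv k (T : Module.End k (MonoidAlgebra k (G ⧸ K))) :=
  rfl

/-- **`ε(T_g) = T_{φ(g)}`**: the isomorphism of Hecke algebras maps double-coset operators to
double-coset operators. -/
theorem heckeAlgebraEquivOfMulEquiv_doubleCosetOp (g : G)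
    [Finite (MulAction.orbit K (g : G ⧸ K))] [Finite (MulAction.orbit K' ((φ g : G') : G' ⧸ K'))] :
    heckeAlgebraEquivOfMulEquiv k φ hK (doubleCosetOp k K g) = doubleCosetOp k K' (φ g) := by
  apply heckeAlgebraEquivInvariants.injective
  apply Subtype.ext
  rw [heckeAlgebraEquivInvariants_apply, heckeAlgebraEquivInvariants_apply,
    doubleCosetOp_apply_single_one, coe_heckeAlgebraEquivOfMulEquiv, LinearEquiv.conjAlgEquiv_apply,
    LinearMap.comp_apply, LinearMap.comp_apply, LinearEquiv.coe_coe, LinearEquiv.coe_coe]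
  have h1 : (permEquivOfMulEquiv k φ hK).symm (MonoidAlgebra.single ((1 : G') : G' ⧸ K') 1) =
      MonoidAlgebra.single ((1 : G) : G ⧸ K) 1 := by
    rw [permEquivOfMulEquiv, MonoidAlgebra.symm_mapDomainLinearEquiv,
      MonoidAlgebra.mapDomainLinearEquiv_single]
    congr 1
    apply (quotientEquivOfMulEquiv φ hK).injective
    rw [Equiv.apply_symm_apply, quotientEquivOfMulEquiv_mk, map_one]
  rw [h1, doubleCosetOp_apply_single_one,
    permEquivOfMulEquiv_orbitVector k φ hK _ (Set.toFinite _), quotientEquivOfMulEquiv_image_orbit]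

end Summit.Ventures.HodgeRepro2.T5HeckeIsomorphismTransportCells
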